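import Mathlib.MeasureTheory.Measure.Haar.Unique
import Mathlib.MeasureTheory.Constructions.Pi
import HarnessLib

/-!
# SoloBlind: level factorisation for equivariant block maps (`YangMills`)

Solo seat `solo-QuantumFields-blind`, deliverable D14 (paper `hierarchical-calibration.md` §8(h),
Lemma L2, group case; claim c81).

## Content

Let `G` be a compact Hausdorff topological group with its normalised Haar probability measure
`μ` (more generally: ANY left-invariant probability measure), and let
`Φ : (ι → G) → G` (`ι` finite) be a measurable BLOCK MAP which is equivariant under the diagonal
left action, `Φ (k • x) = k * Φ x`.  Then the push-forward of the product measure is `μ` again: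

* `map_pi_eq_of_equivariant` : `(Measure.pi fun _ : ι => μ).map Φ = μ`.

More generally (`map_eq_of_equivariant`), for any probability measure `ν` on a measurable space
`X` carrying a measurable `G`-action by measure-preserving maps, every measurable equivariant
`Φ : X → G` pushes `ν` forward to THE invariant probability measure of `G`; and two left-invariant
probability measures on `G` coincide (`eq_of_isMulLeftInvariant_of_isProbabilityMeasure`, a
repackaging of Mathlib's uniqueness of Haar measure).

## Why it is here

This is the mechanism of Lemma L2 of the seat's calibration note: in a hierarchical
("block-variable") renormalisation scheme whose single-block variable lives in a space on which
the symmetry group acts TRANSITIVELY (here: `G` itself, by left multiplication — the case of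
group-valued link or chiral-field variables) and whose block map is equivariant, the law of the
block variable is the invariant law AT EVERY LEVEL, for every such scheme and every compact `G`:
the recursion has no flow at all.  Consequently such caricatures cannot distinguish an abelian
from a non-abelian `G` (obstruction C3″/C7 of the seat's analysis); the distinction must be carried
by a variable on which the group does NOT act transitively (a modulus), or by a running
covariance.  No claim is made here about the summit beyond this calibration fact.
-/

open MeasureTheory

namespace Summit.QuantumFields.YangMills.Theorems.SoloBlind

section Uniqueness

variable {G : Type*} [Group G] [TopologicalSpace G] [IsTopologicalGroup G] [CompactSpace G]
  [MeasurableSpace G] [BorelSpace G]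

/-- On a compact group, a left-invariant probability measure is a Haar measure. -/
theorem isHaarMeasure_of_isMulLeftInvariant_of_isProbabilityMeasure (μ : Measure G)
    [IsProbabilityMeasure μ] [μ.IsMulLeftInvariant] : μ.IsHaarMeasure := by
  have hne : (interior (Set.univ : Set G)).Nonempty := by
    rw [interior_univ]; exact Set.univ_nonempty
  exact Measure.isHaarMeasure_of_isCompact_nonempty_interior μ Set.univ isCompact_univ hne
    (by simp) (by simp)

/-- **Uniqueness of the invariant probability measure** on a compact group: two left-invariant
probability measures coincide. -/
theorem eq_of_isMulLeftInvariant_of_isProbabilityMeasure (μ ν : Measure G)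
    [IsProbabilityMeasure μ] [μ.IsMulLeftInvariant] [IsProbabilityMeasure ν]
    [ν.IsMulLeftInvariant] : ν = μ := by
  haveI := isHaarMeasure_of_isMulLeftInvariant_of_isProbabilityMeasure μ
  haveI := isHaarMeasure_of_isMulLeftInvariant_of_isProbabilityMeasure ν
  exact Measure.isHaarMeasure_eq_of_isProbabilityMeasure ν μ

end Uniqueness

section Equivariant

variable {G : Type*} [Group G] [TopologicalSpace G] [IsTopologicalGroup G] [CompactSpace G]
  [MeasurableSpace G] [BorelSpace G]

/-- **Level factorisation, abstract form.**  Let `ν` be a probability measure on a measurable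
space `X` on which `G` acts (`act k : X → X`) by measurable, `ν`-preserving maps, and let
`Φ : X → G` be measurable and equivariant, `Φ (act k x) = k * Φ x`.  Then `ν.map Φ` is the
(unique) left-invariant probability measure `μ` of `G`. -/
theorem map_eq_of_equivariant {X : Type*} [MeasurableSpace X] (ν : Measure X)
    [IsProbabilityMeasure ν] (act : G → X → X) (hact_meas : ∀ k, Measurable (act k))
    (hact_inv : ∀ k, ν.map (act k) = ν) (Φ : X → G) (hΦ : Measurable Φ)
    (hequiv : ∀ k x, Φ (act k x) = k * Φ x) (μ : Measure G) [IsProbabilityMeasure μ]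
    [μ.IsMulLeftInvariant] : ν.map Φ = μ := by
  haveI : IsProbabilityMeasure (ν.map Φ) := Measure.isProbabilityMeasure_map hΦ.aemeasurable
  haveI : (ν.map Φ).IsMulLeftInvariant := by
    refine ⟨fun k => ?_⟩
    have hmk : Measurable (fun g : G => k * g) := measurable_const_mul k
    calc (ν.map Φ).map (fun g => k * g)
        = ν.map ((fun g => k * g) ∘ Φ) := Measure.map_map hmk hΦ
      _ = ν.map (Φ ∘ act k) := by
          congr 1; funext x; simp [Function.comp, hequiv]
      _ = (ν.map (act k)).map Φ := (Measure.map_map hΦ (hact_meas k)).symm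
      _ = ν.map Φ := by rw [hact_inv k]
  exact eq_of_isMulLeftInvariant_of_isProbabilityMeasure μ (ν.map Φ)

/-- **Level factorisation for block maps (Lemma L2, group case).**  For a compact group `G` with
left-invariant probability measure `μ`, a finite index type `ι`, and a measurable block map
`Φ : (ι → G) → G` equivariant under the diagonal left action, the push-forward of the product
measure `μ^{⊗ι}` under `Φ` is `μ`: the block variable has the invariant law again, whatever the
(equivariant) blocking rule. -/
theorem map_pi_eq_of_equivariant {ι : Type*} [Fintype ι] (μ : Measure G)
    [IsProbabilityMeasure μ] [μ.IsMulLeftInvariant] (Φ : (ι → G) → G) (hΦ : Measurable Φ)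
    (hequiv : ∀ (k : G) (x : ι → G), Φ (fun i => k * x i) = k * Φ x) :
    (Measure.pi fun _ : ι => μ).map Φ = μ := by
  classical
  refine map_eq_of_equivariant (Measure.pi fun _ : ι => μ) (fun k x => fun i => k * x i)
    (fun k => ?_) (fun k => ?_) Φ hΦ hequiv μ
  · exact measurable_pi_lambda _ fun i => (measurable_const_mul k).comp (measurable_pi_apply i)
  · -- the diagonal translate is left multiplication by the constant family in the product group
    have : (fun x : ι → G => fun i => k * x i) = fun x => (fun _ : ι => k) * x := by
      funext x; rfl
    rw [this]
    exact map_mul_left_eq_self _ _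

/-- Iterated form: composing equivariant block maps level by level keeps the invariant law at
every level — if `Φ₁ : (ι → G) → G` and `Φ₂ : (κ → G) → G` are measurable and equivariant, the
two-level block map `x ↦ Φ₂ (fun j => Φ₁ (x j))` on `κ → ι → G` pushes `μ^{⊗(κ×ι)}` to `μ`. -/
theorem map_pi_pi_eq_of_equivariant {ι κ : Type*} [Fintype ι] [Fintype κ] (μ : Measure G)
    [IsProbabilityMeasure μ] [μ.IsMulLeftInvariant]
    (Φ₁ : (ι → G) → G) (hΦ₁ : Measurable Φ₁)
    (hequiv₁ : ∀ (k : G) (x : ι → G), Φ₁ (fun i => k * x i) = k * Φ₁ x)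
    (Φ₂ : (κ → G) → G) (hΦ₂ : Measurable Φ₂)
    (hequiv₂ : ∀ (k : G) (y : κ → G), Φ₂ (fun j => k * y j) = k * Φ₂ y) :
    (Measure.pi fun _ : κ => Measure.pi fun _ : ι => μ).map
        (fun x : κ → ι → G => Φ₂ fun j => Φ₁ (x j)) = μ := by
  classical
  -- first push each inner block forward: the family of inner block variables is i.i.d. `μ`
  have h1 : (Measure.pi fun _ : κ => Measure.pi fun _ : ι => μ).map
      (fun x : κ → ι → G => fun j => Φ₁ (x j)) = Measure.pi fun _ : κ => μ := by
    haveI : ∀ _j : κ, SigmaFinite (Measure.pi fun _ : ι => μ) := fun _ => inferInstance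
    rw [Measure.pi_map_pi (fun _ : κ => hΦ₁.aemeasurable)]
    congr 1; funext j; exact map_pi_eq_of_equivariant μ Φ₁ hΦ₁ hequiv₁
  have hinner : Measurable (fun x : κ → ι → G => fun j => Φ₁ (x j)) :=
    measurable_pi_lambda _ fun j => hΦ₁.comp (measurable_pi_apply j)
  calc (Measure.pi fun _ : κ => Measure.pi fun _ : ι => μ).map
          (fun x : κ → ι → G => Φ₂ fun j => Φ₁ (x j))
        = ((Measure.pi fun _ : κ => Measure.pi fun _ : ι => μ).map
            (fun x : κ → ι → G => fun j => Φ₁ (x j))).map Φ₂ := by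
          rw [Measure.map_map hΦ₂ hinner]; rfl
      _ = (Measure.pi fun _ : κ => μ).map Φ₂ := by rw [h1]
      _ = μ := map_pi_eq_of_equivariant μ Φ₂ hΦ₂ hequiv₂

end Equivariant

end Summit.QuantumFields.YangMills.Theorems.SoloBlind
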